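import Mathlib
import Literature.Analysis.FluidPDE.AxisDistancePowerIntegral
import Literature.Analysis.FluidPDE.CylindricalIntegration
import Literature.Analysis.FluidPDE.AxisymmetricEuler
import Literature.Analysis.FluidPDE.VectorCalculus
import Literature.Analysis.FluidPDE.VorticityCalculus
import HarnessLib

/-!
# Crux `EulerZoomLiouville.PowerGaugeEulerLiouville` (stmt-NavierStokesRegularity-19832), line `casimir-floor`, stub K2:
# THE CASIMIR FLOOR — an enstrophy floor from the mass and the supremum of `|curl v| / r`

Route №10 `EulerZoomLiouville` (NavierStokesRegularity), crux E.  Line `casimir-floor` (ideator ns-idea-11 g3;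
`Cruxes/PowerGaugeEulerLiouville/Lines/casimir_floor.lean`), registered stub `stub_casimirFloor` (K2, "the new lever"), proved here
with its signature UNFOLDED in the tree's vocabulary (the line's private abbreviation `axisLedger v x = ‖curl v x‖ / cylRadius x`
is a `def` of the Cruxes file; the statement below is its `δ`-unfolding, so the skeleton fills the stub by
`theorem stub_casimirFloor : Sig.stub_casimirFloor := casimirFloor`).

THE ESTIMATE (one time slice, no PDE).  Let `v : ℝ³ → ℝ³` be `C¹`, `T ⊆ B(0,a)` measurable, `a, W, m > 0`, and suppose the axis
ledger density `η = |curl v| / r` (`r` = distance to the `x₂`-axis, junk value `0` on the axis) satisfies `η ≤ W` on `T` and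
`∫_T η ≥ m`.  Then
`∫_T |curl v|² ≥ m² / (8 π a (2 + log⁺ (a³ W / m)))`.

PROOF.  Convex duality, pointwise on `T`: for every `s ≥ 0`, `2 s η ≤ |curl v|² + min ((s/r)², 2 W s)` (`(|curl v| − s/r)² ≥ 0`,
resp. `|curl v|² + 2 (s/r)(W r − |curl v|) ≥ 0` using `|curl v| ≤ W r`).  Integrate over `T`, enlarge the penalty integral to the
ball and to the cylinder `{r < a, |x₂| < a}` (Tonelli in cylindrical coordinates, `lintegral_eq_lintegral_cylindrical`):
`2 s m ≤ ∫_T |curl v|² + 4 π a ∫₀^a ρ · min ((s/ρ)², 2 W s) dρ ≤ ∫_T |curl v|² + 4 π a (W s b² + s² log (a/b))` for `0 < b ≤ a`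
(split at `b`: `min ≤ 2 W s` below, `min ≤ (s/ρ)²` above).  With `b² = s/(2W)`, `s = m/(8 π a L)`, `L = 2 + log⁺(a³W/m)` (`b ≤ a` by the
mass bound `m ≤ (4π/3) a³ W`) this is `∫_T |curl v|² ≥ 2 π a s² (4 L − 1 − log (16 π) − log L − log (a³W/m)) ≥ 8 π a L s² = m²/(8 π a L)`,
by the numerical inequality `1 + log (16π) + log L + log (a³W/m) ≤ 4 L` (`log 2 < 0.6932`, `π < 4`, `log L ≤ L − 1`, `log (a³W/m) ≤ L − 2`).

* `two_mul_mul_div_le_sq_add_min` — the pointwise duality inequality;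
* `setLIntegral_Ioo_mul_min_le` — the one-dimensional shell profile bound `∫₀^a ρ min((s/ρ)², 2Ws) dρ ≤ W s b² + s² log(a/b)`;
* `setLIntegral_ball_comp_cylRadius_le` — `∫_{B(0,a)} g(r) dx ≤ 4 π a ∫₀^a ρ g(ρ) dρ` for measurable `g ≥ 0` (cylinder bound);
* `le_of_ledger_mass_le` — the mass bound `m ≤ W · a³ · (4π/3)`;
* **`casimirFloor`** — the stub signature, unfolded.

WHAT THIS IS NOT: not NS, not the crux — a helper `--supports` stmt-19832 on the line `casimir-floor` (a stratum statement about a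
hypothetical Euler zoom-limit class); no summit statement is proved here and nothing here bears on NS regularity itself.  [folklore]
-/

noncomputable section

-- flat `Theorems/<Route><Decl>…` files of one crux share the namespace of the crux (tree convention)
set_option linter.dupNamespace false

open MeasureTheory Set Filter Topology Metric Function Real
open scoped NNReal ENNReal

namespace Summit.NavierStokesRegularity.NavierStokesRegularity.Theorems.PowerGaugeEulerLiouville.CasimirFloor

open Literature.Analysis Literature.Analysis.FluidPDE

/-! ### Pointwise convex duality -/

/-- **Pointwise duality.**  For `r > 0`, `s ≥ 0` and `c / r ≤ W`:
`2 s (c/r) ≤ c² + min ((s/r)², 2 W s)` — with `v = s/r`, `B = W r ≥ c`: either `(c − v)² ≥ 0` or `c² + 2 v (B − c) ≥ 0`. [folklore] -/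
theorem two_mul_mul_div_le_sq_add_min {c r s W : ℝ} (hr : 0 < r) (hs : 0 ≤ s) (hW : c / r ≤ W) :
    2 * s * (c / r) ≤ c ^ 2 + min ((s / r) ^ 2) (2 * W * s) := by
  have hcr : c ≤ W * r := by rwa [div_le_iff₀ hr] at hW
  have hv0 : 0 ≤ s / r := div_nonneg hs hr.le
  have hsv : s = s / r * r := by field_simp
  have h1 : 2 * s * (c / r) = 2 * c * (s / r) := by
    field_simp
  rw [h1]
  rcases le_total ((s / r) ^ 2) (2 * W * s) with h | h
  · rw [min_eq_left h]
    nlinarith [sq_nonneg (c - s / r)]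
  · rw [min_eq_right h]
    have key : 0 ≤ s / r * (W * r - c) := mul_nonneg hv0 (sub_nonneg.2 hcr)
    have e : 2 * W * s = 2 * (s / r) * (W * r) := by
      conv_lhs => rw [hsv]
      ring
    rw [e]
    nlinarith [key, sq_nonneg c]

/-- The duality inequality at a point of the blob, in the tree's vocabulary: if `‖curl v x‖ / cylRadius x ≤ W` then for `s ≥ 0`
`2 s (‖curl v x‖ / cylRadius x) ≤ ‖curl v x‖² + min ((s / cylRadius x)², 2 W s)` (on the axis both ledger terms are the junk
value `0` and the inequality is `0 ≤ ‖curl v x‖² + 0`). [folklore] -/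
theorem two_mul_mul_axisLedger_le (v : EuclideanSpace ℝ (Fin 3) → EuclideanSpace ℝ (Fin 3)) (x : EuclideanSpace ℝ (Fin 3))
    {s W : ℝ} (hs : 0 ≤ s) (hW : 0 ≤ W) (hx : ‖curl v x‖ / cylRadius x ≤ W) :
    2 * s * (‖curl v x‖ / cylRadius x) ≤ ‖curl v x‖ ^ 2 + min ((s / cylRadius x) ^ 2) (2 * W * s) := by
  rcases (cylRadius_nonneg x).eq_or_lt with h0 | hpos
  · rw [← h0, div_zero, div_zero, mul_zero]
    have hmin : min ((0 : ℝ) ^ 2) (2 * W * s) = 0 := by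
      rw [zero_pow two_ne_zero]
      exact min_eq_left (by positivity)
    rw [hmin, add_zero]
    positivity
  · exact two_mul_mul_div_le_sq_add_min hpos hs hx

/-! ### The one-dimensional shell profile -/

/-- **Shell profile bound.**  For `0 < b ≤ a`, `s, W ≥ 0`:
`∫⁻_{(0,a)} ρ · min ((s/ρ)², 2 W s) dρ ≤ W s b² + s² log (a/b)` — split at `b`; below `b` bound `min ≤ 2 W s` and integrate `2 W s ρ`,
above `b` bound `min ≤ (s/ρ)²` and integrate `s²/ρ`. [folklore] -/
theorem setLIntegral_Ioo_mul_min_le {a b s W : ℝ} (hb : 0 < b) (hba : b ≤ a) (hs : 0 ≤ s) (hW : 0 ≤ W) :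
    ∫⁻ ρ in Ioo 0 a, ENNReal.ofReal ρ * ENNReal.ofReal (min ((s / ρ) ^ 2) (2 * W * s)) ≤
      ENNReal.ofReal (W * s * b ^ 2 + s ^ 2 * Real.log (a / b)) := by
  have hsplit : Ioo 0 a ⊆ Ioc 0 b ∪ Icc b a := fun ρ hρ =>
    (le_or_gt ρ b).elim (fun h => Or.inl ⟨hρ.1, h⟩) fun h => Or.inr ⟨h.le, hρ.2.le⟩
  -- the inner part `(0, b]`
  have h1 : ∫⁻ ρ in Ioc 0 b, ENNReal.ofReal ρ * ENNReal.ofReal (min ((s / ρ) ^ 2) (2 * W * s)) ≤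
      ENNReal.ofReal (W * s * b ^ 2) := by
    calc ∫⁻ ρ in Ioc 0 b, ENNReal.ofReal ρ * ENNReal.ofReal (min ((s / ρ) ^ 2) (2 * W * s))
        ≤ ∫⁻ ρ in Ioc 0 b, ENNReal.ofReal (2 * W * s * ρ) := by
          refine setLIntegral_mono' measurableSet_Ioc fun ρ hρ => ?_
          rw [← ENNReal.ofReal_mul hρ.1.le]
          refine ENNReal.ofReal_le_ofReal ?_
          have hmin : min ((s / ρ) ^ 2) (2 * W * s) ≤ 2 * W * s := min_le_right _ _
          nlinarith [hmin, hρ.1]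
      _ = ENNReal.ofReal (∫ ρ in Ioc 0 b, 2 * W * s * ρ) := by
          rw [ofReal_integral_eq_lintegral_ofReal]
          · exact (continuous_const.mul continuous_id).integrableOn_Ioc
          · exact (ae_restrict_iff' measurableSet_Ioc).2 (Eventually.of_forall fun ρ hρ => by
              have : 0 < ρ := hρ.1
              positivity)
      _ = ENNReal.ofReal (W * s * b ^ 2) := by
          congr 1
          rw [← intervalIntegral.integral_of_le hb.le, intervalIntegral.integral_const_mul, integral_id]
          ring
  -- the outer part `[b, a]`
  have h2 : ∫⁻ ρ in Icc b a, ENNReal.ofReal ρ * ENNReal.ofReal (min ((s / ρ) ^ 2) (2 * W * s)) ≤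
      ENNReal.ofReal (s ^ 2 * Real.log (a / b)) := by
    have hcont : ContinuousOn (fun ρ : ℝ => s ^ 2 * ρ⁻¹) (Icc b a) :=
      continuousOn_const.mul (continuousOn_inv₀.mono fun ρ hρ => (hb.trans_le hρ.1).ne')
    calc ∫⁻ ρ in Icc b a, ENNReal.ofReal ρ * ENNReal.ofReal (min ((s / ρ) ^ 2) (2 * W * s))
        ≤ ∫⁻ ρ in Icc b a, ENNReal.ofReal (s ^ 2 * ρ⁻¹) := by
          refine setLIntegral_mono' measurableSet_Icc fun ρ hρ => ?_
          have hρ0 : 0 < ρ := hb.trans_le hρ.1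
          rw [← ENNReal.ofReal_mul hρ0.le]
          refine ENNReal.ofReal_le_ofReal ?_
          calc ρ * min ((s / ρ) ^ 2) (2 * W * s) ≤ ρ * (s / ρ) ^ 2 :=
                mul_le_mul_of_nonneg_left (min_le_left _ _) hρ0.le
            _ = s ^ 2 * ρ⁻¹ := by field_simp
      _ = ENNReal.ofReal (∫ ρ in Icc b a, s ^ 2 * ρ⁻¹) := by
          rw [ofReal_integral_eq_lintegral_ofReal]
          · exact hcont.integrableOn_Icc
          · exact (ae_restrict_iff' measurableSet_Icc).2 (Eventually.of_forall fun ρ hρ => by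
              have : 0 < ρ := hb.trans_le hρ.1
              positivity)
      _ = ENNReal.ofReal (s ^ 2 * Real.log (a / b)) := by
          congr 1
          rw [integral_Icc_eq_integral_Ioc, ← intervalIntegral.integral_of_le hba, intervalIntegral.integral_const_mul,
            integral_inv_of_pos hb (hb.trans_le hba)]
  have hlog : 0 ≤ Real.log (a / b) := Real.log_nonneg (by rwa [le_div_iff₀ hb, one_mul])
  calc ∫⁻ ρ in Ioo 0 a, ENNReal.ofReal ρ * ENNReal.ofReal (min ((s / ρ) ^ 2) (2 * W * s))
      ≤ ∫⁻ ρ in Ioc 0 b ∪ Icc b a, ENNReal.ofReal ρ * ENNReal.ofReal (min ((s / ρ) ^ 2) (2 * W * s)) :=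
        lintegral_mono_set hsplit
    _ ≤ (∫⁻ ρ in Ioc 0 b, ENNReal.ofReal ρ * ENNReal.ofReal (min ((s / ρ) ^ 2) (2 * W * s))) +
          ∫⁻ ρ in Icc b a, ENNReal.ofReal ρ * ENNReal.ofReal (min ((s / ρ) ^ 2) (2 * W * s)) :=
        lintegral_union_le _ _ _
    _ ≤ ENNReal.ofReal (W * s * b ^ 2) + ENNReal.ofReal (s ^ 2 * Real.log (a / b)) := add_le_add h1 h2
    _ = ENNReal.ofReal (W * s * b ^ 2 + s ^ 2 * Real.log (a / b)) :=
        (ENNReal.ofReal_add (by positivity) (mul_nonneg (sq_nonneg _) hlog)).symm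

/-! ### Cylinder bound for radial-in-`r` integrands over a ball -/

/-- The cylindrical radius of `(ρ cos θ, ρ sin θ, z)` is `|ρ|` (private plumbing; the same computation as in
`Literature/Analysis/FluidPDE/AxisDistancePowerIntegral.lean`). [folklore] -/
private theorem cylRadius_cylindricalPt' (ρ θ z : ℝ) :
    cylRadius (WithLp.toLp 2 ![ρ * Real.cos θ, ρ * Real.sin θ, z] : EuclideanSpace ℝ (Fin 3)) = |ρ| := by
  -- adapted from Literature/Analysis/FluidPDE/AxisDistancePowerIntegral.lean (`cylRadius_cylindricalPt`)
  rw [cylRadius]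
  have e : (ρ * Real.cos θ) ^ 2 + (ρ * Real.sin θ) ^ 2 = ρ ^ 2 := by
    linear_combination ρ ^ 2 * Real.sin_sq_add_cos_sq θ
  simp only [Matrix.cons_val_zero, Matrix.cons_val_one]
  rw [e, Real.sqrt_sq_eq_abs]

/-- **Cylinder bound.**  For measurable `g : ℝ → ℝ≥0∞` and `a > 0`:
`∫⁻_{B(0,a)} g (r(x)) dx ≤ 4 π a · ∫⁻_{(0,a)} ρ g(ρ) dρ` — enlarge the ball to the cylinder `{r < a, |x₂| < a}` and use Tonelli in
cylindrical coordinates (`lintegral_eq_lintegral_cylindrical`). [folklore] -/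
theorem setLIntegral_ball_comp_cylRadius_le {g : ℝ → ℝ≥0∞} (hg : Measurable g) {a : ℝ} (ha : 0 < a) :
    ∫⁻ x in ball (0 : EuclideanSpace ℝ (Fin 3)) a, g (cylRadius x) ≤
      ENNReal.ofReal (4 * π * a) * ∫⁻ ρ in Ioo 0 a, ENNReal.ofReal ρ * g ρ := by
  -- adapted from Literature/Analysis/FluidPDE/AxisDistancePowerIntegral.lean (`lintegral_inv_cylRadius_rpow_axisCylinder_le`)
  set S : Set (EuclideanSpace ℝ (Fin 3)) := {x | cylRadius x < a ∧ x 2 ∈ Ioo (-a) a} with hS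
  have h2c : Continuous fun x : EuclideanSpace ℝ (Fin 3) => x 2 := by fun_prop
  have hSm : MeasurableSet S :=
    ((isOpen_lt continuous_cylRadius continuous_const).inter (isOpen_Ioo.preimage h2c)).measurableSet
  have hsub : ball (0 : EuclideanSpace ℝ (Fin 3)) a ⊆ S := by
    intro x hx
    rw [mem_ball, dist_zero_right] at hx
    have hr : cylRadius x ≤ ‖x‖ := by
      rw [cylRadius, EuclideanSpace.norm_eq, Fin.sum_univ_three]
      apply Real.sqrt_le_sqrt
      simp only [Real.norm_eq_abs, sq_abs]
      nlinarith [sq_nonneg (x 2)]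
    refine ⟨hr.trans_lt hx, ?_⟩
    have h2 : |x 2| < a := by
      have h := PiLp.norm_apply_le x 2
      rw [Real.norm_eq_abs] at h
      exact lt_of_le_of_lt h hx
    rw [abs_lt] at h2
    exact ⟨h2.1, h2.2⟩
  set f : EuclideanSpace ℝ (Fin 3) → ℝ≥0∞ := fun x => g (cylRadius x) with hf
  have hfm : Measurable f := hg.comp continuous_cylRadius.measurable
  -- the one-dimensional factors
  set I₁ : ℝ → ℝ≥0∞ := (Ioo (-a) a).indicator 1 with hI₁
  set I₂ : ℝ → ℝ≥0∞ := (Iio a).indicator fun ρ => ENNReal.ofReal ρ * g ρ with hI₂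
  have hI₂m : Measurable I₂ := (ENNReal.measurable_ofReal.mul hg).indicator measurableSet_Iio
  -- the integrand in cylindrical coordinates
  have hpt : ∀ (z θ : ℝ), ∀ ρ ∈ Ioi (0 : ℝ), ENNReal.ofReal ρ *
      S.indicator f (WithLp.toLp 2 ![ρ * Real.cos θ, ρ * Real.sin θ, z]) = I₁ z * I₂ ρ := by
    intro z θ ρ hρ
    have hρ0 : 0 < ρ := hρ
    have hrad : cylRadius (WithLp.toLp 2 ![ρ * Real.cos θ, ρ * Real.sin θ, z] : EuclideanSpace ℝ (Fin 3)) = ρ := by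
      rw [cylRadius_cylindricalPt', abs_of_pos hρ0]
    have hmem : (WithLp.toLp 2 ![ρ * Real.cos θ, ρ * Real.sin θ, z] : EuclideanSpace ℝ (Fin 3)) ∈ S ↔
        ρ < a ∧ z ∈ Ioo (-a) a := by
      simp only [hS, mem_setOf_eq, hrad]
      rfl
    by_cases hz : z ∈ Ioo (-a) a
    · by_cases hρr : ρ < a
      · rw [indicator_of_mem (hmem.2 ⟨hρr, hz⟩), hI₁, hI₂, indicator_of_mem hz,
          indicator_of_mem (show ρ ∈ Iio a from hρr), Pi.one_apply, one_mul, hf]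
        beta_reduce
        rw [hrad]
      · rw [indicator_of_notMem (fun hm => hρr (hmem.1 hm).1), hI₂,
          indicator_of_notMem (show ρ ∉ Iio a from hρr), mul_zero, mul_zero]
    · rw [indicator_of_notMem (fun hm => hz (hmem.1 hm).2), hI₁, indicator_of_notMem hz,
        zero_mul, mul_zero]
  -- Tonelli in cylindrical coordinates
  have hinner : ∀ z θ : ℝ, ∫⁻ ρ in Ioi (0 : ℝ), ENNReal.ofReal ρ *
      S.indicator f (WithLp.toLp 2 ![ρ * Real.cos θ, ρ * Real.sin θ, z]) =
      I₁ z * ∫⁻ ρ in Ioo 0 a, ENNReal.ofReal ρ * g ρ := by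
    intro z θ
    rw [setLIntegral_congr_fun measurableSet_Ioi (hpt z θ), lintegral_const_mul _ hI₂m, hI₂,
      lintegral_indicator measurableSet_Iio, Measure.restrict_restrict measurableSet_Iio,
      Iio_inter_Ioi]
  have hI₁m : Measurable I₁ := measurable_one.indicator measurableSet_Ioo
  calc ∫⁻ x in ball (0 : EuclideanSpace ℝ (Fin 3)) a, f x ≤ ∫⁻ x in S, f x := lintegral_mono_set hsub
    _ = ∫⁻ x, S.indicator f x := (lintegral_indicator hSm _).symm
    _ = ∫⁻ z : ℝ, ∫⁻ θ in Ioo (-Real.pi) Real.pi, ∫⁻ ρ in Ioi (0 : ℝ),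
          ENNReal.ofReal ρ * S.indicator f (WithLp.toLp 2 ![ρ * Real.cos θ, ρ * Real.sin θ, z]) :=
        lintegral_eq_lintegral_cylindrical (hfm.indicator hSm)
    _ = ∫⁻ z : ℝ, ∫⁻ _θ in Ioo (-Real.pi) Real.pi, I₁ z * ∫⁻ ρ in Ioo 0 a, ENNReal.ofReal ρ * g ρ := by
        simp_rw [hinner]
    _ = ENNReal.ofReal (4 * π * a) * ∫⁻ ρ in Ioo 0 a, ENNReal.ofReal ρ * g ρ := by
        simp_rw [setLIntegral_const, mul_assoc]
        rw [lintegral_mul_const _ hI₁m, hI₁, lintegral_indicator_one measurableSet_Ioo, Real.volume_Ioo, Real.volume_Ioo]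
        have ha2 : 0 ≤ a - -a := by linarith
        have hpi : 0 ≤ Real.pi - -Real.pi := by linarith [Real.pi_pos]
        rw [mul_comm (∫⁻ ρ in Ioo 0 a, ENNReal.ofReal ρ * g ρ) _, ← mul_assoc, ← ENNReal.ofReal_mul ha2]
        congr 1
        congr 1
        ring

/-! ### The mass bound -/

/-- **Mass bound.**  If the ledger density is `≤ W` on a measurable `T ⊆ B(0,a)` (`W ≥ 0`) and its lower integral over `T` is at
least `m`, then `m ≤ W · a³ · (4π/3)` (the volume of the ball, `EuclideanSpace.volume_ball_fin_three`). [folklore] -/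
theorem le_of_ledger_mass_le {η : EuclideanSpace ℝ (Fin 3) → ℝ} {T : Set (EuclideanSpace ℝ (Fin 3))} {a W m : ℝ}
    (ha : 0 ≤ a) (hW : 0 ≤ W) (hT : MeasurableSet T) (hTa : T ⊆ ball (0 : EuclideanSpace ℝ (Fin 3)) a)
    (hη : ∀ x ∈ T, η x ≤ W) (hm : ENNReal.ofReal m ≤ ∫⁻ x in T, ENNReal.ofReal (η x)) :
    m ≤ W * (a ^ 3 * (π * 4 / 3)) := by
  have h1 : ∫⁻ x in T, ENNReal.ofReal (η x) ≤ ENNReal.ofReal W * volume (ball (0 : EuclideanSpace ℝ (Fin 3)) a) := by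
    calc ∫⁻ x in T, ENNReal.ofReal (η x) ≤ ∫⁻ _ in T, ENNReal.ofReal W :=
          setLIntegral_mono' hT fun x hx => ENNReal.ofReal_le_ofReal (hη x hx)
      _ = ENNReal.ofReal W * volume T := setLIntegral_const _ _
      _ ≤ ENNReal.ofReal W * volume (ball (0 : EuclideanSpace ℝ (Fin 3)) a) := by gcongr
  rw [EuclideanSpace.volume_ball_fin_three, ← ENNReal.ofReal_pow ha, ← ENNReal.ofReal_mul (pow_nonneg ha 3),
    ← ENNReal.ofReal_mul hW] at h1
  exact (ENNReal.ofReal_le_ofReal_iff (by positivity)).1 (hm.trans h1)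

/-! ### Numerical inequality -/

/-- `log (16 π) < 4.16` (`π < 4`, `log 2 < 0.6931471808`). [folklore] -/
theorem log_sixteen_mul_pi_lt : Real.log (16 * π) < 4.16 := by
  have h1 : Real.log (16 * π) < Real.log 64 :=
    Real.log_lt_log (by positivity) (by nlinarith [Real.pi_lt_four])
  have h2 : Real.log 64 = 6 * Real.log 2 := by
    rw [show (64 : ℝ) = 2 ^ 6 by norm_num, Real.log_pow]
    norm_num
  have h3 := Real.log_two_lt_d9
  linarith

/-- The bookkeeping inequality behind the choice `s = m / (8 π a L)`: for `L ≥ 2` and `X > 0` with `log X ≤ L − 2`,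
`1 + log (16 π) + log L + log X ≤ 4 L`. [folklore] -/
theorem one_add_logs_le_four_mul {L X : ℝ} (hL : 2 ≤ L) (hX : Real.log X ≤ L - 2) :
    1 + Real.log (16 * π) + Real.log L + Real.log X ≤ 4 * L := by
  have h1 := log_sixteen_mul_pi_lt
  have h2 : Real.log L ≤ L - 1 := Real.log_le_sub_one_of_pos (by linarith)
  linarith

/-! ### The Casimir floor -/

/-- **THE CASIMIR FLOOR** (stub K2 `stub_casimirFloor` of the line `casimir-floor`, signature `Sig.stub_casimirFloor = CasimirFloor`
with `axisLedger v x := ‖curl v x‖ / cylRadius x` unfolded).  A `C¹` field `v`, a measurable blob `T ⊆ B(0,a)` on which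
`|curl v| / r ≤ W` and whose ledger mass `∫_T |curl v| / r` is at least `m > 0` carries enstrophy
`∫_T |curl v|² ≥ m² / (8 π a (2 + log⁺ (a³ W / m)))`.  Proof in the module docstring (pointwise duality against the azimuthal potential
`s/r`, cylindrical shell bound, `s = m/(8 π a L)`). [folklore] -/
theorem casimirFloor :
    ∀ (v : EuclideanSpace ℝ (Fin 3) → EuclideanSpace ℝ (Fin 3)) (T : Set (EuclideanSpace ℝ (Fin 3))) (a W m : ℝ),
      ContDiff ℝ 1 v → 0 < a → 0 < W → 0 < m → MeasurableSet T → T ⊆ ball (0 : EuclideanSpace ℝ (Fin 3)) a →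
      (∀ x ∈ T, ‖curl v x‖ / cylRadius x ≤ W) →
      ENNReal.ofReal m ≤ ∫⁻ x in T, ENNReal.ofReal (‖curl v x‖ / cylRadius x) →
        ENNReal.ofReal (m ^ 2 / (8 * π * a * (2 + max 0 (Real.log (a ^ 3 * W / m))))) ≤
          ∫⁻ x in T, ENNReal.ofReal (‖curl v x‖ ^ 2) := by
  intro v T a W m hv ha hW hm hT hTa hη hmass
  -- the parameters
  set L : ℝ := 2 + max 0 (Real.log (a ^ 3 * W / m)) with hL
  have hL2 : 2 ≤ L := by rw [hL]; linarith [le_max_left 0 (Real.log (a ^ 3 * W / m))]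
  have hL0 : 0 < L := by linarith
  have hlogX : Real.log (a ^ 3 * W / m) ≤ L - 2 := by rw [hL]; linarith [le_max_right 0 (Real.log (a ^ 3 * W / m))]
  set s : ℝ := m / (8 * π * a * L) with hs_def
  have hs : 0 < s := by positivity
  have hms : m = 8 * π * a * L * s := by rw [hs_def]; field_simp
  set b : ℝ := Real.sqrt (s / (2 * W)) with hb_def
  have hb2 : b ^ 2 = s / (2 * W) := by rw [hb_def]; exact Real.sq_sqrt (by positivity)
  have hb : 0 < b := by rw [hb_def]; exact Real.sqrt_pos.2 (by positivity)
  -- mass bound ⇒ `b ≤ a`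
  have hmvol : m ≤ W * (a ^ 3 * (π * 4 / 3)) := le_of_ledger_mass_le ha.le hW.le hT hTa hη hmass
  have hba : b ≤ a := by
    have h1 : b ^ 2 ≤ a ^ 2 := by
      rw [hb2, div_le_iff₀ (by positivity), hs_def, div_le_iff₀ (by positivity)]
      -- `m ≤ a² · 2W · 8πaL`, from the mass bound and `L ≥ 2`
      have h' : 0 ≤ W * a ^ 3 * π := by positivity
      nlinarith [h', hL2, hmvol]
    exact (pow_le_pow_iff_left₀ hb.le ha.le two_ne_zero).1 h1
  have _hπ0 : (π : ℝ) ≠ 0 := Real.pi_pos.ne'; have _hm0 : m ≠ 0 := hm.ne'; have _hL0' : L ≠ 0 := hL0.ne'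
  have _ha0 : a ≠ 0 := ha.ne'; have _hW0 : W ≠ 0 := hW.ne'; have _hs0 : s ≠ 0 := hs.ne'; have _hb0 : b ≠ 0 := hb.ne'
  -- measurability
  have hcurl : Continuous (curl v) := continuous_curl hv
  have hfm : Measurable fun x : EuclideanSpace ℝ (Fin 3) => ENNReal.ofReal (‖curl v x‖ ^ 2) :=
    ENNReal.measurable_ofReal.comp ((hcurl.norm).pow 2).measurable
  -- the radial penalty `g(ρ) = min ((s/ρ)², 2 W s)`
  set g : ℝ → ℝ≥0∞ := fun ρ => ENNReal.ofReal (min ((s / ρ) ^ 2) (2 * W * s)) with hg_def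
  have hgm : Measurable g :=
    ENNReal.measurable_ofReal.comp (((measurable_const.div measurable_id).pow_const 2).min measurable_const)
  -- Step 1: integrate the pointwise duality over `T`
  have key : ENNReal.ofReal (2 * s) * ∫⁻ x in T, ENNReal.ofReal (‖curl v x‖ / cylRadius x) ≤
      (∫⁻ x in T, ENNReal.ofReal (‖curl v x‖ ^ 2)) + ∫⁻ x in T, g (cylRadius x) := by
    rw [← lintegral_const_mul' _ _ ENNReal.ofReal_ne_top, ← lintegral_add_left hfm]
    refine setLIntegral_mono' hT fun x hx => ?_
    show ENNReal.ofReal (2 * s) * ENNReal.ofReal (‖curl v x‖ / cylRadius x) ≤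
      ENNReal.ofReal (‖curl v x‖ ^ 2) + ENNReal.ofReal (min ((s / cylRadius x) ^ 2) (2 * W * s))
    rw [← ENNReal.ofReal_mul (by positivity),
      ← ENNReal.ofReal_add (sq_nonneg _) (le_min (sq_nonneg _) (by positivity))]
    exact ENNReal.ofReal_le_ofReal (two_mul_mul_axisLedger_le v x hs.le hW.le (hη x hx))
  -- Step 2: the penalty integral over `T ⊆ B(0,a)` (cylinder bound + shell profile)
  have hpen : ∫⁻ x in T, g (cylRadius x) ≤
      ENNReal.ofReal (4 * π * a * (W * s * b ^ 2 + s ^ 2 * Real.log (a / b))) := by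
    calc ∫⁻ x in T, g (cylRadius x) ≤ ∫⁻ x in ball (0 : EuclideanSpace ℝ (Fin 3)) a, g (cylRadius x) :=
          lintegral_mono_set hTa
      _ ≤ ENNReal.ofReal (4 * π * a) * ∫⁻ ρ in Ioo 0 a, ENNReal.ofReal ρ * g ρ :=
          setLIntegral_ball_comp_cylRadius_le hgm ha
      _ ≤ ENNReal.ofReal (4 * π * a) * ENNReal.ofReal (W * s * b ^ 2 + s ^ 2 * Real.log (a / b)) := by
          gcongr
          exact setLIntegral_Ioo_mul_min_le hb hba hs.le hW.le
      _ = ENNReal.ofReal (4 * π * a * (W * s * b ^ 2 + s ^ 2 * Real.log (a / b))) :=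
          (ENNReal.ofReal_mul (by positivity)).symm
  -- Step 3: `2 s m ≤ ∫_T |curl v|² + Ψ` in `ℝ≥0∞`
  set Ψ : ℝ := 4 * π * a * (W * s * b ^ 2 + s ^ 2 * Real.log (a / b)) with hΨ
  have hlogab : 0 ≤ Real.log (a / b) := Real.log_nonneg (by rwa [le_div_iff₀ hb, one_mul])
  have hΨ0 : 0 ≤ Ψ := by
    rw [hΨ]
    have : 0 ≤ W * s * b ^ 2 + s ^ 2 * Real.log (a / b) := by positivity
    positivity
  have h2sm : ENNReal.ofReal (2 * s * m) ≤ (∫⁻ x in T, ENNReal.ofReal (‖curl v x‖ ^ 2)) + ENNReal.ofReal Ψ := by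
    calc ENNReal.ofReal (2 * s * m) = ENNReal.ofReal (2 * s) * ENNReal.ofReal m := by
          rw [ENNReal.ofReal_mul (by positivity)]
      _ ≤ ENNReal.ofReal (2 * s) * ∫⁻ x in T, ENNReal.ofReal (‖curl v x‖ / cylRadius x) := by gcongr
      _ ≤ (∫⁻ x in T, ENNReal.ofReal (‖curl v x‖ ^ 2)) + ∫⁻ x in T, g (cylRadius x) := key
      _ ≤ (∫⁻ x in T, ENNReal.ofReal (‖curl v x‖ ^ 2)) + ENNReal.ofReal Ψ := add_le_add le_rfl hpen
  -- Step 4: the real inequality `m² / (8 π a L) ≤ 2 s m − Ψ`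
  have h2log : 2 * Real.log (a / b) = Real.log (16 * π) + Real.log L + Real.log (a ^ 3 * W / m) := by
    have hab : (a / b) ^ 2 = 16 * π * L * (a ^ 3 * W / m) := by
      rw [div_pow, hb2, hs_def]
      field_simp
      ring
    calc 2 * Real.log (a / b) = Real.log ((a / b) ^ 2) := by rw [Real.log_pow]; norm_num
      _ = Real.log (16 * π * L * (a ^ 3 * W / m)) := by rw [hab]
      _ = Real.log (16 * π) + Real.log L + Real.log (a ^ 3 * W / m) := by
          rw [Real.log_mul (by positivity) (by positivity), Real.log_mul (by positivity) (by positivity)]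
  have hnum : 1 + Real.log (16 * π) + Real.log L + Real.log (a ^ 3 * W / m) ≤ 4 * L :=
    one_add_logs_le_four_mul hL2 hlogX
  have hreal : m ^ 2 / (8 * π * a * L) ≤ 2 * s * m - Ψ := by
    have e1 : m ^ 2 / (8 * π * a * L) = 8 * π * a * L * s ^ 2 := by rw [hms]; field_simp
    have e2 : 2 * s * m = 16 * π * a * L * s ^ 2 := by rw [hms]; ring
    have e3 : Ψ = 2 * π * a * s ^ 2 * (1 + 2 * Real.log (a / b)) := by rw [hΨ, hb2]; field_simp; ring
    rw [e1, e2, e3, h2log]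
    have hpas : 0 ≤ 2 * π * a * s ^ 2 := by positivity
    nlinarith [mul_nonneg hpas (sub_nonneg.2 hnum)]
  -- Step 5: conclude
  calc ENNReal.ofReal (m ^ 2 / (8 * π * a * L)) ≤ ENNReal.ofReal (2 * s * m - Ψ) := ENNReal.ofReal_le_ofReal hreal
    _ = ENNReal.ofReal (2 * s * m) - ENNReal.ofReal Ψ := ENNReal.ofReal_sub _ hΨ0
    _ ≤ ∫⁻ x in T, ENNReal.ofReal (‖curl v x‖ ^ 2) := tsub_le_iff_right.2 h2sm

end Summit.NavierStokesRegularity.NavierStokesRegularity.Theorems.PowerGaugeEulerLiouville.CasimirFloor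

end
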